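import Summits.CriticalPhenomena.Ising3DConformalLimit.Theorems.RotationJoining.Negative.Geometry
import Summits.CriticalPhenomena.Ising3DConformalLimit.Theorems.RotationJoining.Negative.ShiftInequality

/-!
# `RotationJoining` (crux stmt-CriticalPhenomena-18763), negative-side support, module 3:
# the translation-invariant counter-measure `μL` (horizontally layered i.i.d. fair spins)

`μL := (⨂_{j∈ℤ} coin).map layer`, `layer ε x := ε (x 2)`: configurations constant on the planes
`x₂ = const`, the plane values i.i.d. fair `±1`. Recorded here: `μL` is translation invariant
(`isTranslationInvariant_μL`); layer spins are centred and orthonormal in `L²(P)`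
(`integral_spinAt_P`, `integral_spinAt_mul_spinAt_P`), so a block sum of a layered configuration
is a linear form in the layer spins with the LAYER PROFILE as coefficients (`blockSum_layer`) and
`E[(Σ c_j ε_j)²] = Σ c_j²` (`integral_sq_linear_P`); at scale `n = 3k` the reference rotated block
sum has second moment `V₀(k) = Σ_j profile_j² ≥ 1` and the difference of the rotated block sums at
`u = 0` and `u = e₀` has second moment `V₁(k) = Σ_j (profile_j − profile_{j+k})² ≥ V₀(k)/25`
(`V0_le`, by the telescoping inequality: the profile lives on `< 5k` layers and the two cells are
translates with layer shift `k`), while the two AXIS block sums `u = 0`, `u = e₀` of a layered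
configuration coincide (`blockSum_axisCell_e0_layer`).

Refuter cdisprove seat (cycle 1); nothing here refutes the crux.
-/

namespace Summit.CriticalPhenomena.Ising3DConformalLimit.Theorems.RotationJoining.Negative

open MeasureTheory Finset
open Literature.Probability.LatticeModels

noncomputable section

/-- Spins of a layered configuration are the layer spins. -/
theorem spinAt_layer (x : Site 3) (ε : ℤ → ℤˣ) : spinAt x (layer ε) = spinAt (x 2) ε := rfl

/-- `μL` is translation invariant (a shift of `ℤ³` acts on the layers by a shift of `ℤ`). -/
theorem isTranslationInvariant_μL : IsTranslationInvariantMeasure μL := by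
  intro v
  have hre : Measurable (fun (ε : ℤ → ℤˣ) (j : ℤ) => ε (Equiv.subRight (v 2) j)) :=
    measurable_pi_lambda _ (fun j => measurable_pi_apply _)
  have hcomp : (configShift v) ∘ layer =
      layer ∘ (fun (ε : ℤ → ℤˣ) (j : ℤ) => ε (Equiv.subRight (v 2) j)) := by
    funext ε; funext x
    simp [layer, configShift_apply, Equiv.subRight_apply]
  unfold μL
  rw [Measure.map_map (configShift v).measurable measurable_layer, hcomp,
    ← Measure.map_map measurable_layer hre]
  unfold P
  rw [map_reindex_infinitePi coin (Equiv.subRight (v 2))]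

/-! ### Moments of the layer spins -/

/-- Integration against the fair coin. -/
theorem integral_coin (f : ℤˣ → ℝ) : ∫ u, f u ∂coin = 2⁻¹ * f 1 + 2⁻¹ * f (-1) := by
  simp only [coin]
  rw [integral_add_measure (Integrable.of_finite.smul_measure (by simp))
    (Integrable.of_finite.smul_measure (by simp)), integral_smul_measure,
    integral_smul_measure, integral_dirac, integral_dirac]
  simp

/-- Layer spins are centred. -/
theorem integral_spinAt_P (j : ℤ) : ∫ ε, spinAt j ε ∂P = 0 := by
  have h1 : ∫ ε, spinAt j ε ∂P = ∫ u : ℤˣ, (((u : ℤˣ) : ℤ) : ℝ) ∂(P.map (fun ε : ℤ → ℤˣ => ε j)) := by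
    rw [integral_map (measurable_pi_apply j).aemeasurable
      (measurable_of_countable _).aestronglyMeasurable]
    rfl
  rw [h1]
  unfold P
  rw [Measure.infinitePi_map_eval (fun _ : ℤ => coin) j, integral_coin]
  simp

/-- Layer spins are orthonormal in `L²(P)`. -/
theorem integral_spinAt_mul_spinAt_P (i j : ℤ) :
    ∫ ε, spinAt i ε * spinAt j ε ∂P = if i = j then 1 else 0 := by
  classical
  split_ifs with h
  · subst h
    simp [← sq]
  · have hdep : ∀ l : ℤ, DependsOn (fun ε : ℤ → ℤˣ => spinAt l ε) ({l} : Finset ℤ) :=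
      fun l x y hxy => by simp only [spinAt, hxy l (by simp)]
    have := integral_mul_eq_of_dependsOn_disjoint (fun _ : ℤ => coin) (S := {i}) (T := {j})
      (Finset.disjoint_singleton.2 h) (measurable_spinAt i) (measurable_spinAt j) (hdep i) (hdep j)
    unfold P
    rw [this]
    change (∫ ε, spinAt i ε ∂P) * ∫ ε, spinAt j ε ∂P = 0
    rw [integral_spinAt_P, zero_mul]

/-- Second moment of a linear form in i.i.d. fair spins: `E[(Σ c_j ε_j)²] = Σ c_j²`. -/
theorem integral_sq_linear_P (K : Finset ℤ) (c : ℤ → ℝ) :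
    ∫ ε, (∑ j ∈ K, c j * spinAt j ε) ^ 2 ∂P = ∑ j ∈ K, c j ^ 2 := by
  classical
  have hint : ∀ i j, Integrable (fun ε : ℤ → ℤˣ => c i * spinAt i ε * (c j * spinAt j ε)) P := by
    intro i j
    refine Integrable.of_bound (Measurable.aestronglyMeasurable (by fun_prop)) (|c i| * |c j|)
      (ae_of_all _ (fun ε => ?_))
    rw [Real.norm_eq_abs, abs_mul, abs_mul, abs_mul, abs_spinAt, abs_spinAt]; simp
  calc ∫ ε, (∑ j ∈ K, c j * spinAt j ε) ^ 2 ∂P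
      = ∫ ε, ∑ i ∈ K, ∑ j ∈ K, c i * spinAt i ε * (c j * spinAt j ε) ∂P := by
          congr 1; funext ε; rw [sq, Finset.sum_mul_sum]
    _ = ∑ i ∈ K, ∑ j ∈ K, ∫ ε, c i * spinAt i ε * (c j * spinAt j ε) ∂P := by
          rw [integral_finsetSum _ (fun i _ => integrable_finsetSum _ (fun j _ => hint i j))]
          refine Finset.sum_congr rfl (fun i _ => ?_)
          rw [integral_finsetSum _ (fun j _ => hint i j)]
    _ = ∑ i ∈ K, ∑ j ∈ K, c i * c j * (if i = j then 1 else 0) := by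
          refine Finset.sum_congr rfl (fun i _ => Finset.sum_congr rfl (fun j _ => ?_))
          have : (fun ε : ℤ → ℤˣ => c i * spinAt i ε * (c j * spinAt j ε)) =
              fun ε => (c i * c j) * (spinAt i ε * spinAt j ε) := by funext ε; ring
          rw [this, integral_const_mul, integral_spinAt_mul_spinAt_P]
    _ = ∑ i ∈ K, c i ^ 2 := by
          refine Finset.sum_congr rfl (fun i hi => ?_)
          simp [mul_ite, Finset.sum_ite_eq, hi, sq]

/-! ### Block sums of layered configurations: layer profiles -/

/-- A block sum of a layered configuration is a linear form in the layer spins with the layer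
profile as coefficients. -/
theorem blockSum_layer (s : Finset (Site 3)) (K : Finset ℤ) (hK : ∀ x ∈ s, x 2 ∈ K) (ε : ℤ → ℤˣ) :
    blockSum s (layer ε) = ∑ j ∈ K, profile s j * spinAt j ε := by
  unfold blockSum profile
  simp_rw [spinAt_layer]
  have h := Finset.sum_fiberwise_of_maps_to' (s := s) (t := K) (g := fun x : Site 3 => x 2) hK
    (fun j => spinAt j ε)
  rw [← h]
  refine Finset.sum_congr rfl fun j _ => ?_
  rw [Finset.sum_const, nsmul_eq_mul]

/-- The layer profile of a translate is the translated profile. -/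
theorem profile_map_addRight (s : Finset (Site 3)) (t : Site 3) (j : ℤ) :
    profile (s.map (addRightEmbedding t)) j = profile s (j - t 2) := by
  unfold profile
  rw [Finset.filter_map, Finset.card_map]
  congr 2
  refine Finset.filter_congr (fun x _ => ?_)
  simp only [Function.comp_apply, addRightEmbedding_apply, Pi.add_apply]
  omega

/-- Block sum over a translated set. -/
theorem blockSum_map_addRight (s : Finset (Site 3)) (t : Site 3) (σ : SpinConfig (Site 3)) :
    blockSum (s.map (addRightEmbedding t)) σ = ∑ x ∈ s, spinAt (x + t) σ := by
  unfold blockSum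
  rw [Finset.sum_map]
  rfl

/-- Block sums (of this module's `blockSum`) are measurable, in the `fun`-form `fun_prop` uses. -/
@[fun_prop]
theorem measurable_fun_blockSum (s : Finset (Site 3)) :
    Measurable fun σ : SpinConfig (Site 3) => blockSum s σ := by
  unfold blockSum
  exact Finset.measurable_sum _ (fun x _ => measurable_spinAt x)

/-- `‖Σ_{x∈s} σ_x‖ ≤ #s`. -/
theorem norm_blockSum_le (s : Finset (Site 3)) (σ : SpinConfig (Site 3)) : ‖blockSum s σ‖ ≤ s.card := by
  rw [Real.norm_eq_abs]
  unfold blockSum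
  calc |∑ x ∈ s, spinAt x σ| ≤ ∑ x ∈ s, |spinAt x σ| := Finset.abs_sum_le_sum_abs _ _
    _ = s.card := by simp

/-! ### The two cells at scale `n = 3k` read through `μL` -/

/-- Layers met by the reference rotated cell lie in the window. -/
theorem layer_mem_Kwin_of_mem_rotCell₀ {k : ℕ} {x : Site 3} (hx : x ∈ rotCell₀ (3 * k) 1) :
    x 2 ∈ Kwin k := by
  have := layer_bounds_of_mem_rotCell₀ hx
  rw [Kwin, Finset.mem_Icc]; omega

/-- The reference rotated block sum as a linear form in the layer spins. -/
theorem blockSum_rotCell₀_layer (k : ℕ) (ε : ℤ → ℤˣ) :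
    blockSum (rotCell₀ (3 * k) 1) (layer ε) =
      ∑ j ∈ Kwin k, profile (rotCell₀ (3 * k) 1) j * spinAt j ε :=
  blockSum_layer _ _ (fun _ hx => layer_mem_Kwin_of_mem_rotCell₀ hx) ε

/-- The rotated block sum at `e₀` as a linear form in the layer spins: the SHIFTED profile. -/
theorem blockSum_rotCell_e0_layer (k : ℕ) (ε : ℤ → ℤˣ) :
    blockSum (rotCell (3 * k) 1 (Pi.single 0 1)) (layer ε) =
      ∑ j ∈ Kwin k, profile (rotCell₀ (3 * k) 1) (j + k) * spinAt j ε := by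
  rw [rotCell_e0_eq_map]
  have hK : ∀ x ∈ (rotCell₀ (3 * k) 1).map (addRightEmbedding (tvec k)), x 2 ∈ Kwin k := by
    intro x hx
    rw [Finset.mem_map] at hx
    obtain ⟨y, hy, rfl⟩ := hx
    have := layer_bounds_of_mem_rotCell₀ hy
    simp only [addRightEmbedding_apply, Pi.add_apply, tvec_two, Kwin, Finset.mem_Icc]
    omega
  rw [blockSum_layer _ _ hK]
  refine Finset.sum_congr rfl fun j _ => ?_
  rw [profile_map_addRight, tvec_two, sub_neg_eq_add]

/-- The two axis block sums `u = 0`, `u = e₀` of a layered configuration coincide. -/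
theorem blockSum_axisCell_e0_layer (n : ℕ) (ε : ℤ → ℤˣ) :
    blockSum (axisCell n (Pi.single 0 1)) (layer ε) = blockSum (axisCell₀ n) (layer ε) := by
  rw [axisCell_e0_eq_map, blockSum_map_addRight]
  unfold blockSum
  refine Finset.sum_congr rfl fun x _ => ?_
  simp [spinAt_layer]

/-- Second moment of the reference rotated block sum under `P ∘ layer⁻¹`. -/
theorem integral_sq_blockSum_rotCell₀ (k : ℕ) :
    ∫ ε, (blockSum (rotCell₀ (3 * k) 1) (layer ε)) ^ 2 ∂P = V0 k := by
  simp_rw [blockSum_rotCell₀_layer]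
  exact integral_sq_linear_P _ _

/-- Second moment of the difference of the two rotated block sums under `P ∘ layer⁻¹`. -/
theorem integral_sq_blockSum_sub (k : ℕ) :
    ∫ ε, (blockSum (rotCell₀ (3 * k) 1) (layer ε) -
      blockSum (rotCell (3 * k) 1 (Pi.single 0 1)) (layer ε)) ^ 2 ∂P = V1 k := by
  simp_rw [blockSum_rotCell₀_layer, blockSum_rotCell_e0_layer, ← Finset.sum_sub_distrib, ← sub_mul]
  exact integral_sq_linear_P _ _

/-- `V₀ ≥ 1` (the origin's layer is met). -/
theorem one_le_V0 {k : ℕ} (hk : 1 ≤ k) : 1 ≤ V0 k := by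
  have h0 : (0 : Site 3) ∈ rotCell₀ (3 * k) 1 := zero_mem_rotCell₀ 1 (by omega)
  have hprof : 1 ≤ profile (rotCell₀ (3 * k) 1) 0 := by
    unfold profile
    have : 0 < ((rotCell₀ (3 * k) 1).filter (fun x => x 2 = 0)).card :=
      Finset.card_pos.2 ⟨0, Finset.mem_filter.2 ⟨h0, rfl⟩⟩
    exact_mod_cast this
  have hmem : (0:ℤ) ∈ Kwin k := by rw [Kwin, Finset.mem_Icc]; omega
  calc (1:ℝ) ≤ profile (rotCell₀ (3 * k) 1) 0 ^ 2 := by nlinarith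
    _ ≤ V0 k := Finset.single_le_sum (f := fun j => profile (rotCell₀ (3 * k) 1) j ^ 2)
        (fun j _ => sq_nonneg _) hmem

/-- `V₀ ≤ 25 V₁`: the telescoping inequality applied to the layer profile (support `< 5k`,
shift `k`). -/
theorem V0_le (k : ℕ) : V0 k ≤ 25 * V1 k := by
  have h := sum_sq_le_sq_mul_sum_sq_sub_shift (profile (rotCell₀ (3 * k) 1)) (-(k:ℤ) + 1) k 5
    (fun j hj => ?_) (Kwin k) (fun j h1 h2 => ?_)
  · norm_num at h
    exact h
  · -- support of the profile
    unfold profile at hj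
    have hne : ((rotCell₀ (3 * k) 1).filter (fun x => x 2 = j)).Nonempty := by
      rw [← Finset.card_pos]
      have : ((rotCell₀ (3 * k) 1).filter (fun x => x 2 = j)).card ≠ 0 := by exact_mod_cast hj
      omega
    obtain ⟨x, hx⟩ := hne
    rw [Finset.mem_filter] at hx
    have := layer_bounds_of_mem_rotCell₀ hx.1
    push_cast
    omega
  · rw [Kwin, Finset.mem_Icc]
    push_cast at h2
    omega

/-- `V₀ ≥ 0`. -/
theorem V0_nonneg (k : ℕ) : 0 ≤ V0 k := Finset.sum_nonneg (fun _ _ => sq_nonneg _)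

end

end Summit.CriticalPhenomena.Ising3DConformalLimit.Theorems.RotationJoining.Negative
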